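import Summits.Ventures.LatticeQCDFlow.Scaling.UnitSurvivalRecursion
import Summits.Ventures.LatticeQCDFlow.Scaling.UnitSurvivalFloor
import Literature.Probability.MarkovChains.LpDistance

/-!
HONEST FRAMING: exact (Metropolis-corrected) sampling algorithms for lattice gauge theory; figures
of merit are autocorrelation/cost numbers at stated couplings and volumes; no continuum-physics
claim.

# UnitSurvivalSecondMoment — THE SECOND-MOMENT SURVIVAL FLOOR FOR THE IDEALISED HOT-ONLY STAR AT UNIFORM LISTING:
# WITH `K` VALUES `s` PLANTED AT THE COLD LEVELS, `a_n = E_xΦ_n ≥ (1−λ)ⁿK`, `a_n ≤ (1−ρ)ⁿK + E_a·ν(s)`,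
# `q_n = E_xΦ_n² ≤ (1−2λ)ⁿK² + B·K·(1−ρ)ⁿ/(2λ−ρ) + E_q·ν(s)/(2λ)` (`λ = t(1−t)/K`, `ρ = λ − λt²/(K(1−λ))`), AND
# `d(n) ≥ a_n²/q_n − (K+1)ν(s)` (PALEY–ZYGMUND) (lean-2 GEN-27, ours)

Venture-side (OURS).  Cell `lqcd-flow` (pub-lqcd), unit `pub-lqcd-lean-2-g27`, 2026-08-27.  Chapter M, the floor side,
file 7 (the `log K` programme, step 3).  Setting of `Scaling/UnitSurvivalRecursion` (idealised hot-only star, exact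
hot sampler, identity maps, uniform listing: `m = cK`, every multiplicity `= c`; `λ = t(1−t)c/m`, `κ₁ = tc/m`).
The planted start `x_s^u`: `s` at every cold level, `u ≠ s` at the hub.

## What is proved

* §1 real sequences: `seq_ge_of_step_ge`, `seq_le_of_step_le`, `seq_le_of_step_le_conv` (first-order recursions with a
  geometric forcing term: `u_{n+1} ≤ αu_n + βWθⁿ + γ ⇒ u_n ≤ αⁿu_0 + βWθⁿ/(θ−α) + γ/(1−α)`).
* §2 `lawMean_sq_le_mass_mul` — Paley–Zygmund on a finite space: `(E_μΦ)² ≤ μ{Φ > 0}·E_μΦ²` for `μ, Φ ≥ 0`.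
* §3 the planted sequences `a_n, b_n, q_n`: **`planted_potential_ge`** (`a_n ≥ (1−λ)ⁿK`), **`planted_potential_le`**,
  **`planted_potentialSq_le`**, and **`unitSurvival_secondMoment_worstTvDist_ge`** —
  `d(n) ≥ a_n²/q_n − (K+1)·ν(s)` with the two closed-form bounds substituted.

Reading (no numerics implied): at `n ≈ (1/λ)·log(K/M)` the right side is `≈ M²/(M² + O(M)) − (K+1)ν(s)`, i.e. the
star is not `1/4`-mixed before `(K/(t(1−t)))·(log K − O(1))` steps when the configuration space is large — the
`log K` on the unit-survival floor; the constant-chasing corollary is the sequel.  NOT CLAIMED here: the corollary in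
closed `K·log K` form; anything measured.  Literature grade (cell rule): OWN RESULT (two-moment method); Cauchy–Schwarz
from the tree's `piInner_sq_le_mul`; nothing cited as a fact; no new bib keys.
-/

noncomputable section

open Finset Function
open Literature.Probability.MarkovChains

namespace Summit.Ventures.LatticeQCDFlow.Scaling

/-! ## §1 First-order recursions with geometric forcing -/

section Seq

/-- `u_{n+1} ≥ α·u_n`, `α ≥ 0` ⇒ `u_n ≥ αⁿ·u_0`. [ours] -/
theorem seq_ge_of_step_ge {u : ℕ → ℝ} {α : ℝ} (hα : 0 ≤ α) (h : ∀ n, α * u n ≤ u (n + 1)) :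
    ∀ n, α ^ n * u 0 ≤ u n := by
  intro n
  induction n with
  | zero => simp
  | succ n ih =>
    calc α ^ (n + 1) * u 0 = α * (α ^ n * u 0) := by ring
      _ ≤ α * u n := mul_le_mul_of_nonneg_left ih hα
      _ ≤ u (n + 1) := h n

/-- `u_{n+1} ≤ α·u_n + γ`, `0 ≤ α < 1`, `γ ≥ 0` ⇒ `u_n ≤ αⁿ·u_0 + γ/(1−α)`. [ours] -/
theorem seq_le_of_step_le {u : ℕ → ℝ} {α γ : ℝ} (hα0 : 0 ≤ α) (hα1 : α < 1) (hγ : 0 ≤ γ)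
    (h : ∀ n, u (n + 1) ≤ α * u n + γ) : ∀ n, u n ≤ α ^ n * u 0 + γ / (1 - α) := by
  have h1α : 0 < 1 - α := by linarith
  intro n
  induction n with
  | zero => simp only [pow_zero, one_mul]; linarith [div_nonneg hγ h1α.le]
  | succ n ih =>
    calc u (n + 1) ≤ α * u n + γ := h n
      _ ≤ α * (α ^ n * u 0 + γ / (1 - α)) + γ := by linarith [mul_le_mul_of_nonneg_left ih hα0]
      _ = α ^ (n + 1) * u 0 + γ / (1 - α) := by field_simp; ring

/-- `u_{n+1} ≤ α·u_n + β·w_n + γ` with `w_n ≤ W·θⁿ + W₀`, `0 ≤ α < θ ≤ 1`, `α < 1`, `β, W, W₀, γ ≥ 0` ⇒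
**`u_n ≤ αⁿ·u_0 + βWθⁿ/(θ−α) + (βW₀ + γ)/(1−α)`**. [ours] -/
theorem seq_le_of_step_le_conv {u w : ℕ → ℝ} {α β γ θ W W₀ : ℝ} (hα0 : 0 ≤ α) (hαθ : α < θ) (hθ1 : θ ≤ 1)
    (hβ : 0 ≤ β) (hW : 0 ≤ W) (hW₀ : 0 ≤ W₀) (hγ : 0 ≤ γ)
    (hw : ∀ n, w n ≤ W * θ ^ n + W₀) (h : ∀ n, u (n + 1) ≤ α * u n + β * w n + γ) :
    ∀ n, u n ≤ α ^ n * u 0 + β * W * θ ^ n / (θ - α) + (β * W₀ + γ) / (1 - α) := by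
  have hα1 : α < 1 := lt_of_lt_of_le hαθ hθ1
  have h1α : 0 < 1 - α := by linarith
  have hθα : 0 < θ - α := by linarith
  have hθ0 : 0 ≤ θ := by linarith
  intro n
  induction n with
  | zero =>
    simp only [pow_zero, one_mul, mul_one]
    have : 0 ≤ β * W / (θ - α) := div_nonneg (mul_nonneg hβ hW) hθα.le
    have : 0 ≤ (β * W₀ + γ) / (1 - α) := div_nonneg (by positivity) h1α.le
    linarith
  | succ n ih =>
    have hwn := hw n
    calc u (n + 1) ≤ α * u n + β * w n + γ := h n
      _ ≤ α * (α ^ n * u 0 + β * W * θ ^ n / (θ - α) + (β * W₀ + γ) / (1 - α)) + β * (W * θ ^ n + W₀) + γ := by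
          nlinarith [mul_le_mul_of_nonneg_left ih hα0, mul_le_mul_of_nonneg_left hwn hβ]
      _ = α ^ (n + 1) * u 0 + β * W * θ ^ (n + 1) / (θ - α) + (β * W₀ + γ) / (1 - α) := by
          field_simp
          ring

end Seq

/-! ## §2 Paley–Zygmund on a finite space -/

section PZ
variable {X : Type*} [Fintype X]

/-- **`(E_μΦ)² ≤ μ{Φ > 0}·E_μΦ²`** for `μ ≥ 0` and `Φ ≥ 0` (Cauchy–Schwarz against the indicator of `{Φ > 0}`).
[ours] -/
theorem lawMean_sq_le_mass_mul [DecidableEq X] {μ Φ : X → ℝ} (hμ : ∀ x, 0 ≤ μ x) (hΦ : ∀ x, 0 ≤ Φ x) :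
    lawMean μ Φ ^ 2 ≤ (∑ x ∈ univ.filter (fun x => 0 < Φ x), μ x) * lawMean μ (fun x => Φ x ^ 2) := by
  have hcs := piInner_sq_le_mul hμ (fun x => if 0 < Φ x then (1 : ℝ) else 0) Φ
  have h1 : piInner μ (fun x => if 0 < Φ x then (1 : ℝ) else 0) Φ = lawMean μ Φ := by
    unfold piInner lawMean
    refine sum_congr rfl fun x _ => ?_
    show μ x * ((if 0 < Φ x then (1 : ℝ) else 0) * Φ x) = μ x * Φ x
    by_cases hx : 0 < Φ x
    · rw [if_pos hx, one_mul]
    · rw [if_neg hx, zero_mul, le_antisymm (not_lt.mp hx) (hΦ x), mul_zero]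
  have h2 : piInner μ (fun x => if 0 < Φ x then (1 : ℝ) else 0) (fun x => if 0 < Φ x then (1 : ℝ) else 0)
      = ∑ x ∈ univ.filter (fun x => 0 < Φ x), μ x := by
    unfold piInner
    rw [Finset.sum_filter]
    refine sum_congr rfl fun x _ => ?_
    show μ x * ((if 0 < Φ x then (1 : ℝ) else 0) * (if 0 < Φ x then (1 : ℝ) else 0)) = if 0 < Φ x then μ x else 0
    split_ifs <;> simp
  have h3 : piInner μ Φ Φ = lawMean μ (fun x => Φ x ^ 2) := by
    unfold piInner lawMean
    exact sum_congr rfl fun x _ => by ring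
  rw [h1, h2, h3] at hcs
  exact hcs

/-- **PALEY–ZYGMUND: `μ{Φ > 0} ≥ (E_μΦ)²/E_μΦ²`** (`μ, Φ ≥ 0`, `E_μΦ² > 0`). [ours] -/
theorem mass_pos_ge_of_moments [DecidableEq X] {μ Φ : X → ℝ} (hμ : ∀ x, 0 ≤ μ x) (hΦ : ∀ x, 0 ≤ Φ x)
    (hq : 0 < lawMean μ (fun x => Φ x ^ 2)) :
    lawMean μ Φ ^ 2 / lawMean μ (fun x => Φ x ^ 2) ≤ ∑ x ∈ univ.filter (fun x => 0 < Φ x), μ x := by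
  rw [div_le_iff₀ hq]
  exact lawMean_sq_le_mass_mul hμ hΦ

end PZ


/-! ## §3 The planted sequences and the second-moment floor -/

section Planted
variable {S : Type*} [Fintype S] [DecidableEq S] {K m : ℕ} {ν : S → ℝ} {M : Fin (K + 1) → S → S → ℝ} {t : ℝ}
variable (κ : Fin m → Fin K)

/-- **THE FIRST MOMENT FROM BELOW: `a_n ≥ (1−λ)ⁿ·K`** for the planted start (`λ = t(1−t)c/m ≤ 1`). [ours] -/
theorem planted_potential_ge (hm : 1 ≤ m) (ht0 : 0 ≤ t) (ht1 : t ≤ 1) (hν : ∀ v, 0 < ν v) (hν1 : ∑ v, ν v = 1)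
    (hM : ∀ k, IsRowStochastic (M k)) (hM0 : ∀ u v, M 0 u v = ν v)
    {c : ℕ} (hcu : ∀ p' : Fin K, (univ.filter (fun r : Fin m => κ r = p')).card = c) (hcm : c ≤ m)
    (s u : S) (hus : u ≠ s) {f : (Fin (K + 1) → S) → ℝ} (hf : ∀ z, f z = ∑ k : Fin K, (if z k.succ = s then (1 : ℝ) else 0))
    {g : (Fin (K + 1) → S) → ℝ} (hg : ∀ z, g z = if z 0 = s then (1 : ℝ) else 0) (n : ℕ) :
    (1 - t * (1 - t) * c / m) ^ n * K
      ≤ lawMean (lawAt (fun y z : Fin (K + 1) → S => t * ptGraphSwap (fun _ : Fin (K + 1) => ν)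
          (fun r : Fin m => (((0 : Fin (K + 1)), (κ r).succ) : Fin (K + 1) × Fin (K + 1))) (fun _ => Equiv.refl S) y z
        + (1 - t) * prodKernel (fun k : Fin (K + 1) => if k = 0 then (1 : ℝ) else 0) M y z)
        (Pi.single (Fin.cons u (fun _ : Fin K => s) : Fin (K + 1) → S) 1) n) (fun z => f z + t * g z) := by
  have hμ' : ∀ (k : Fin (K + 1)) (v : S), 0 < (fun _ : Fin (K + 1) => ν) k v := fun _ v => hν v
  have hw0 : ∀ k : Fin (K + 1), 0 ≤ (if k = 0 then (1 : ℝ) else 0) := fun k => by split_ifs <;> norm_num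
  have hw1 : ∑ k : Fin (K + 1), (if k = 0 then (1 : ℝ) else 0) = 1 := by
    rw [Finset.sum_ite_eq' univ (0 : Fin (K + 1)), if_pos (mem_univ _)]
  have hP := weightedScheme_isRowStochastic (t := t) (w := fun k : Fin (K + 1) => if k = 0 then (1 : ℝ) else 0)
    (ptGraphSwap_isRowStochastic (e := fun r : Fin m => (((0 : Fin (K + 1)), (κ r).succ) : Fin (K + 1) × Fin (K + 1)))
      (φ := fun _ => Equiv.refl S) hμ') hM hw0 hw1 ht0 ht1
  have hδ : ∀ a, 0 ≤ (Pi.single (Fin.cons u (fun _ : Fin K => s) : Fin (K + 1) → S) (1 : ℝ) : _ → ℝ) a := fun a => by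
    by_cases ha : a = (Fin.cons u (fun _ : Fin K => s) : Fin (K + 1) → S)
    · subst ha; rw [Pi.single_eq_same]; norm_num
    · rw [Pi.single_eq_of_ne ha]
  have hmpos : (0 : ℝ) < m := Nat.cast_pos.mpr (by omega)
  have hlam1 : 0 ≤ 1 - t * (1 - t) * c / m := by
    rw [sub_nonneg, div_le_one hmpos]
    have hcm' : (c : ℝ) ≤ m := by exact_mod_cast hcm
    have h1 : t * (1 - t) ≤ 1 := by nlinarith
    have h2 : 0 ≤ t * (1 - t) := mul_nonneg ht0 (by linarith)
    nlinarith
  have h0 : lawMean (lawAt (fun y z : Fin (K + 1) → S => t * ptGraphSwap (fun _ : Fin (K + 1) => ν)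
          (fun r : Fin m => (((0 : Fin (K + 1)), (κ r).succ) : Fin (K + 1) × Fin (K + 1))) (fun _ => Equiv.refl S) y z
        + (1 - t) * prodKernel (fun k : Fin (K + 1) => if k = 0 then (1 : ℝ) else 0) M y z)
        (Pi.single (Fin.cons u (fun _ : Fin K => s) : Fin (K + 1) → S) 1) 0) (fun z => f z + t * g z) = K := by
    rw [lawAt_zero, lawMean_single]
    obtain ⟨hfx, hgx⟩ := planted_values (K := K) s u hus hf hg
    simp only [hfx, hgx, mul_zero, add_zero]
  have h := seq_ge_of_step_ge (u := fun n => lawMean (lawAt (fun y z : Fin (K + 1) → S =>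
      t * ptGraphSwap (fun _ : Fin (K + 1) => ν)
          (fun r : Fin m => (((0 : Fin (K + 1)), (κ r).succ) : Fin (K + 1) × Fin (K + 1))) (fun _ => Equiv.refl S) y z
        + (1 - t) * prodKernel (fun k : Fin (K + 1) => if k = 0 then (1 : ℝ) else 0) M y z)
        (Pi.single (Fin.cons u (fun _ : Fin K => s) : Fin (K + 1) → S) 1) n) (fun z => f z + t * g z)) hlam1
    (fun n => by
      simp only [lawAt_succ]
      exact recursion_potential_ge κ hm ht0 ht1 hν hν1 hM0 hcu s hf hg (lawAt_nonneg hP hδ n)) n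
  simp only [h0] at h
  exact h

/-- **THE FIRST MOMENT OF THE POTENTIAL DOMINATES ITS SECOND MOMENT RATIO: `(E_μΦ)² ≤ E_μΦ²`** for a probability
vector `μ` (`Φ ≥ 0`). [ours] -/
theorem lawMean_sq_le_lawMean_sq {X : Type*} [Fintype X] [DecidableEq X] {μ Φ : X → ℝ} (hμ : ∀ x, 0 ≤ μ x)
    (hμ1 : ∑ x, μ x = 1) (hΦ : ∀ x, 0 ≤ Φ x) : lawMean μ Φ ^ 2 ≤ lawMean μ (fun x => Φ x ^ 2) := by
  have h := lawMean_sq_le_mass_mul hμ hΦ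
  have hmass : ∑ x ∈ univ.filter (fun x => 0 < Φ x), μ x ≤ 1 := by
    rw [← hμ1]; exact Finset.sum_le_sum_of_subset_of_nonneg (Finset.filter_subset _ _) fun x _ _ => hμ x
  have hq : 0 ≤ lawMean μ (fun x => Φ x ^ 2) := by
    unfold lawMean; exact sum_nonneg fun x _ => mul_nonneg (hμ x) (sq_nonneg _)
  nlinarith

/-- **THE SECOND-MOMENT DISTANCE FLOOR (abstract form):** if at time `n` the planted chain has `E_xΦ_n ≥ A ≥ 0` and
`E_xΦ_n² ≤ Q`, then **`d(n) ≥ A²/Q − (K+1)·ν(s)`** (Paley–Zygmund; the event `{Φ_n > 0}` forces a copy of `s`). [ours] -/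
theorem unitSurvival_worstTvDist_ge_of_moments (ht0 : 0 ≤ t) (ht1 : t ≤ 1)
    (hν : ∀ v, 0 < ν v) (hν1 : ∑ v, ν v = 1) (hM : ∀ k, IsRowStochastic (M k))
    (s u : S) {f : (Fin (K + 1) → S) → ℝ} (hf : ∀ z, f z = ∑ k : Fin K, (if z k.succ = s then (1 : ℝ) else 0))
    {g : (Fin (K + 1) → S) → ℝ} (hg : ∀ z, g z = if z 0 = s then (1 : ℝ) else 0) (n : ℕ) {A Q : ℝ} (hA0 : 0 ≤ A)
    (hA : A ≤ lawMean (lawAt (fun y z : Fin (K + 1) → S => t * ptGraphSwap (fun _ : Fin (K + 1) => ν)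
          (fun r : Fin m => (((0 : Fin (K + 1)), (κ r).succ) : Fin (K + 1) × Fin (K + 1))) (fun _ => Equiv.refl S) y z
        + (1 - t) * prodKernel (fun k : Fin (K + 1) => if k = 0 then (1 : ℝ) else 0) M y z)
        (Pi.single (Fin.cons u (fun _ : Fin K => s) : Fin (K + 1) → S) 1) n) (fun z => f z + t * g z))
    (hQ' : lawMean (lawAt (fun y z : Fin (K + 1) → S => t * ptGraphSwap (fun _ : Fin (K + 1) => ν)
          (fun r : Fin m => (((0 : Fin (K + 1)), (κ r).succ) : Fin (K + 1) × Fin (K + 1))) (fun _ => Equiv.refl S) y z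
        + (1 - t) * prodKernel (fun k : Fin (K + 1) => if k = 0 then (1 : ℝ) else 0) M y z)
        (Pi.single (Fin.cons u (fun _ : Fin K => s) : Fin (K + 1) → S) 1) n) (fun z => (f z + t * g z) ^ 2) ≤ Q) :
    A ^ 2 / Q - ((K : ℝ) + 1) * ν s
      ≤ worstTvDist (fun y z : Fin (K + 1) → S => t * ptGraphSwap (fun _ : Fin (K + 1) => ν)
          (fun r : Fin m => (((0 : Fin (K + 1)), (κ r).succ) : Fin (K + 1) × Fin (K + 1))) (fun _ => Equiv.refl S) y z
        + (1 - t) * prodKernel (fun k : Fin (K + 1) => if k = 0 then (1 : ℝ) else 0) M y z)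
        (tensorFun (fun _ : Fin (K + 1) => ν)) n := by
  set P := (fun y z : Fin (K + 1) → S => t * ptGraphSwap (fun _ : Fin (K + 1) => ν)
          (fun r : Fin m => (((0 : Fin (K + 1)), (κ r).succ) : Fin (K + 1) × Fin (K + 1))) (fun _ => Equiv.refl S) y z
        + (1 - t) * prodKernel (fun k : Fin (K + 1) => if k = 0 then (1 : ℝ) else 0) M y z) with hP_def
  set x : Fin (K + 1) → S := (Fin.cons u (fun _ : Fin K => s) : Fin (K + 1) → S) with hx_def
  have hμ' : ∀ (k : Fin (K + 1)) (v : S), 0 < (fun _ : Fin (K + 1) => ν) k v := fun _ v => hν v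
  have hμ1 : ∀ k : Fin (K + 1), ∑ v, (fun _ : Fin (K + 1) => ν) k v = 1 := fun _ => hν1
  have hw0 : ∀ k : Fin (K + 1), 0 ≤ (if k = 0 then (1 : ℝ) else 0) := fun k => by split_ifs <;> norm_num
  have hw1 : ∑ k : Fin (K + 1), (if k = 0 then (1 : ℝ) else 0) = 1 := by
    rw [Finset.sum_ite_eq' univ (0 : Fin (K + 1)), if_pos (mem_univ _)]
  have hPst : IsRowStochastic P := weightedScheme_isRowStochastic (t := t)
    (w := fun k : Fin (K + 1) => if k = 0 then (1 : ℝ) else 0)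
    (ptGraphSwap_isRowStochastic (e := fun r : Fin m => (((0 : Fin (K + 1)), (κ r).succ) : Fin (K + 1) × Fin (K + 1)))
      (φ := fun _ => Equiv.refl S) hμ') hM hw0 hw1 ht0 ht1
  have hδ : ∀ a, 0 ≤ (Pi.single x (1 : ℝ) : _ → ℝ) a := fun a => by
    by_cases ha : a = x
    · subst ha; rw [Pi.single_eq_same]; norm_num
    · rw [Pi.single_eq_of_ne ha]
  have hnn : ∀ z, 0 ≤ lawAt P (Pi.single x 1) n z := fun z => lawAt_nonneg hPst hδ n z
  have hΦ0 : ∀ z, 0 ≤ f z + t * g z := fun z => by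
    have := (coldCount_mem s hf z).1; have := (hubInd_mem s hg z).1; positivity
  -- Paley–Zygmund: `P_x(Φ_n > 0) ≥ A²/Q`
  have hq0 : 0 < lawMean (lawAt P (Pi.single x 1) n) (fun z => (f z + t * g z) ^ 2) ∨ A = 0 := by
    by_cases hA' : A = 0
    · exact Or.inr hA'
    · left
      have hApos : 0 < A := lt_of_le_of_ne hA0 (Ne.symm hA')
      have hmass1 : ∑ z, lawAt P (Pi.single x 1) n z = 1 := by rw [sum_lawAt hPst, Finset.sum_pi_single', if_pos (mem_univ _)]
      have := lawMean_sq_le_lawMean_sq hnn hmass1 hΦ0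
      nlinarith
  have hev : A ^ 2 / Q ≤ ∑ z ∈ univ.filter (fun z : Fin (K + 1) → S => 0 < f z + t * g z), lawAt P (Pi.single x 1) n z := by
    rcases hq0 with hq0 | hA'
    · have hpz := mass_pos_ge_of_moments hnn hΦ0 hq0
      refine le_trans ?_ hpz
      have hnum : A ^ 2 ≤ lawMean (lawAt P (Pi.single x 1) n) (fun z => f z + t * g z) ^ 2 :=
        pow_le_pow_left₀ hA0 hA 2
      calc A ^ 2 / Q ≤ A ^ 2 / lawMean (lawAt P (Pi.single x 1) n) (fun z => (f z + t * g z) ^ 2) :=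
            div_le_div_of_nonneg_left (sq_nonneg A) hq0 hQ'
        _ ≤ _ := div_le_div_of_nonneg_right hnum hq0.le
    · rw [hA', zero_pow two_ne_zero, zero_div]
      exact sum_nonneg fun z _ => hnn z
  -- `{Φ > 0} ⊆ {∃ k, z_k = s}`
  have hsub : ∑ z ∈ univ.filter (fun z : Fin (K + 1) → S => 0 < f z + t * g z), lawAt P (Pi.single x 1) n z
      ≤ ∑ z ∈ univ.filter (fun z : Fin (K + 1) → S => ∃ k ∈ (univ : Finset (Fin (K + 1))), z k = (fun _ : Fin (K + 1) => s) k),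
          lawAt P (Pi.single x 1) n z := by
    refine Finset.sum_le_sum_of_subset_of_nonneg (fun z hz => ?_) (fun z _ _ => hnn z)
    rw [Finset.mem_filter] at hz ⊢
    refine ⟨mem_univ _, ?_⟩
    by_contra hnone
    push Not at hnone
    have hf0 : f z = 0 := by
      rw [hf]; exact sum_eq_zero fun k _ => if_neg (hnone k.succ (mem_univ _))
    have hg0 : g z = 0 := by rw [hg]; exact if_neg (hnone 0 (mem_univ _))
    have := hz.2; rw [hf0, hg0] at this; linarith
  have hπA := tensorFun_mass_someKept_le hμ' hμ1 (fun _ : Fin (K + 1) => s) (univ : Finset (Fin (K + 1)))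
  have hπA' : ∑ z ∈ univ.filter (fun z : Fin (K + 1) → S => ∃ k ∈ (univ : Finset (Fin (K + 1))), z k = (fun _ : Fin (K + 1) => s) k),
      tensorFun (fun _ : Fin (K + 1) => ν) z ≤ ((K : ℝ) + 1) * ν s := by
    refine hπA.trans (le_of_eq ?_)
    simp only [sum_const, card_univ, Fintype.card_fin, nsmul_eq_mul, Nat.cast_add, Nat.cast_one]
  have hmass : ∑ z, lawAt P (Pi.single x 1) n z = ∑ z, tensorFun (fun _ : Fin (K + 1) => ν) z := by
    rw [sum_lawAt hPst, Finset.sum_pi_single', if_pos (mem_univ _), sum_tensorFun_eq_one _ hμ1]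
  have htv := sub_sum_le_tvDist hmass
    (univ.filter (fun z : Fin (K + 1) → S => ∃ k ∈ (univ : Finset (Fin (K + 1))), z k = (fun _ : Fin (K + 1) => s) k))
  have hw := tvDist_single_le_worstTvDist P (tensorFun (fun _ : Fin (K + 1) => ν)) n x
  linarith

end Planted

end Summit.Ventures.LatticeQCDFlow.Scaling

end
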